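import Summits.QuantumFields.BalabanUV.Beta.D1BFx.GluonNeedleSplit
import Summits.QuantumFields.BalabanUV.Beta.D1BFx.Assembly

/-!
# `BalabanUV.Beta.D1BFx.GluonNeedleGlue` — road «BF-x» for binder row D1, slot (K), END row `hGrp gN`, «GN-33 ∕ GLUE»: THE GLUON NEEDLE ROW T₃ FROM ITS
# NINE CELLS — `h₃` of `NeedleRowGlue.abs_gN_row_le_of_tables` VERBATIM from ONE n-uniform bound per cell of `SbRblk ⊗ SbRblk` (with its weight `cK²`, `±cK`,
# `±1` inside) and the pins of record (`hlam`, `cE = n⁴`, `cR = −cE`): `C₃ := 2N²·Σ C_cell`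

HONEST DEPENDENCY (cell records, verbatim): «continuum YM on T⁴ ⇐ BetaPertH ∧ nine spine estimates (0/9 proved); BetaPertH ⇐ (D1) ∧ (D4) ∧
CAP+tail; G-an2-4 gates asym, D1 and NE2/3/4.»  HONEST FRAMING (cell contract, verbatim): «discharging `BetaPertH` makes Bałaban's UV stability
UNCONDITIONAL — a real constructive-QFT result; it is NOT the continuum limit and NOT the Clay problem.»  THIS MODULE DISCHARGES NOTHING of the
wall: [folklore] bookkeeping BY NAME over gan24-leaf-05-g41's «GN-SPLIT» (`GluonNeedleSplit.biBubbleTable_SbRblk_SbRblk_eq` ∕ `_SbRc_SbRc_eq` ∕ `prefactor₃_eq`,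
the piece localisations), leaf-03's `FineHessianSectors.absMoment₂_baseKer_biBubbleTable`, the owner's `Assembly.exists_tendsto_psum_weight_mul` and the
Literature (1.22)-currency `WindowIdentification.fullSum_add` ∕ `fullSum_const_mul`.  No `def`, no `def … : Prop`, nothing cited, 0 sorry.  The nine CELL BOUNDS
are HYPOTHESES (one is a tree theorem so far: `NeedleProjProjRow.exists_projProj_row_le`, p261786); the pins are slot (K)'s displayed letters, ruled nowhere here.
Root-level binders hW ∕ hR-sockets ∕ hSX-socket ∕ D1Tel ∕ D1Rep — 0 discharged; (K) NOT closed; NOT D1, NOT `BetaPertH`, NOT continuum, NOT Clay.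

ABSOLUTE RULE (cell charter, verbatim): «No internally-minted statement may enter as a cited fact. Every hypothesis is either kernel-proved in
this package or a verbatim quotation of a PUBLISHED theorem with page reference. The manuscript(s) under audit are NOT citable for their own
disputed steps — they are the thing under adjudication; programme-internal (2001/route/tribunal) claims are never citable.»

WHY (owner claim table «GN-CELLS» = `HOME/b2b-balaban-beta-d1-p2/GLUON-NEEDLE-ROWS.md` v0.2, row GLUE).  T₃ is the `h₃` hypothesis of `NeedleRowGlue.abs_gN_row_le_of_tables`:
`|ωgl n·Σ_b n⁻⁴·(n⁻⁸·fullSum (w ↦ w_μw_ν·biBubbleTable (Ga)(Ga) SbRc SbRc μ ν (b+w) b))| ≤ C₃`.  At the pins `SbRc ⊗ SbRc = cR²·SbRblk ⊗ SbRblk`, `ωgl·cR²·n⁻⁸ = 2N²`,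
and `SbRblk ⊗ SbRblk` is the signed sum of nine piece words; this file moves the (1.22) sum and the base average through that finite sum — each word's
(1.22) series converges absolutely because every piece is bi-localised at its bond UNIFORMLY in the bond (§1) and the leg is spread — so that T₃ follows
from one n-uniform bound per cell.  Cells land one by one («GN-33∕PP» ✓; PK, KK, R3 cells claimable); when all nine are in, `h₃` is a theorem modulo the
pins and the printed leg letters.

CONTENT (`a > 0`, block side `n ≥ 1`).
* §1 [folklore] UNIFORM bond localisation of the three pieces: `exists_biLoc_projPiece`, `exists_biLoc_dipPiece`, `exists_biLoc_ndlPiece` (one `(C, δ)` for all bonds).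
* §2 [folklore] (CONV) per cell: `conv_cell` (`∃ B, Tendsto (psum (w ↦ w_μw_ν·biBubbleTable (Ga)(Ga) S T μ ν (b+w) b)) atTop (𝓝 B)` for uniformly bi-localised `S`, `T`),
  `fullSum_sub`, `conv_sub`, `fullSum_lin3`, `conv_lin3`, `fullSum_nine`.
* §3 [folklore] **`fullSum_SbRblk_SbRblk_eq`** — the (1.22) sum of `SbRblk ⊗ SbRblk` at one base site = the weighted sum of the nine cell sums; **`avg_fullSum_SbRblk_SbRblk_eq`** —
  the same after the base average `Σ_b n⁻⁴`; `abs_nine_le` (triangle inequality for the nine-term combination).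
* §4 [folklore] **`h₃_of_cells`** — `h₃` VERBATIM from the nine cell bounds + `hlam` + `cE = n⁴` + `cR = −cE`, `C₃ := 2N²·(C_dd + C_dn + C_dp + C_nd + C_nn + C_np + C_pd + C_pn + C_pp)`.
Unit `b2b-balaban-beta-d1-p2` (gen 10), road «BF-x» OWNER; `LEAVES-BFx.md` row (N) «GN-33∕GLUE».
-/

noncomputable section

namespace Summit.QuantumFields.BalabanUV.Beta.D1BFx.GluonNeedleGlue

open Finset Filter Topology
open scoped BigOperators
open Literature.MathematicalPhysics.QuantumFieldTheory.Balaban1983to89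
open Literature.MathematicalPhysics.QuantumFieldTheory.Balaban1983to89.Beta
open ExpKernelCalculus (Site MKer Decays BiLoc)
open KernelWard (biLoc_add biLoc_sub)
open StepJetData (biLoc_smul)
open DyadicShell (Pt toReal toReal_apply)
open WindowIdentification (psum fullSum fullSum_add fullSum_const_mul exists_tendsto_psum_add)
open DressedMomentNormalisation (resSite)
open Summit.QuantumFields.BalabanUV.Beta.TameKernelCalculus (Spr biLoc_trK)
open Summit.QuantumFields.BalabanUV.Beta.D1BFx.ReducedKernel (StencilR)
open Summit.QuantumFields.BalabanUV.Beta.D1BFx.GluonLeg (Ga)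
open Summit.QuantumFields.BalabanUV.Beta.D1BFx.GhostStencil (biLoc_ghCur)
open Summit.QuantumFields.BalabanUV.Beta.D1BFx.RJetAssembly (biLoc_dSw biLoc_dJetSw_of_decays)
open Summit.QuantumFields.BalabanUV.Beta.D1BFx.RProjectorJet (biLoc_cornerV biLoc_cornerJ)
open Summit.QuantumFields.BalabanUV.Beta.D1BFx.RJetProjector (decays_Pgt)
open Summit.QuantumFields.BalabanUV.Beta.D1BFx.FineStencilBFBalaban (rate0 rate0_pos)
open Summit.QuantumFields.BalabanUV.Beta.D1BFx.SectorRecut (SbRc)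
open Summit.QuantumFields.BalabanUV.Beta.D1BFx.GaugeJetLocal (SbRblk)
open Summit.QuantumFields.BalabanUV.Beta.D1BFx.GaugeJetWords (exists_biLoc_SbRblk)
open Summit.QuantumFields.BalabanUV.Beta.D1BFx.FineHessianSectors (biBubbleTable absMoment₂_baseKer_biBubbleTable)
open Summit.QuantumFields.BalabanUV.Beta.D1BFx.Assembly (exists_tendsto_psum_weight_mul exists_tendsto_psum_const_mul)
open Summit.QuantumFields.BalabanUV.Beta.D1BFx.GluonNeedleSplit (projPiece dipPiece ndlPiece decays_Ggh_rate0 biLoc_qAnti_rate0 biLoc_Jq_rate0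
  biBubbleTable_SbRblk_SbRblk_eq biBubbleTable_SbRc_SbRc_eq prefactor₃_eq)

variable (n : ℕ) [NeZero n] (a : ℝ)

/-! ## §1 Uniform bond localisation of the three pieces -/

/-- [folklore] The projector-jet piece is bi-localised at its bond, ONE `(C, δ)` for all bonds. -/
theorem exists_biLoc_projPiece (ha : 0 < a) :
    ∃ C δ : ℝ, 0 < δ ∧ ∀ (κ : Fin 4) (u : Site 4), BiLoc (projPiece n a κ u) u u C δ :=
  ⟨_, rate0 n a, rate0_pos n a ha, fun κ u => biLoc_dJetSw_of_decays κ u (rate0_pos n a ha).le (decays_Pgt n a ha)⟩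

/-- [folklore] The dipole piece is bi-localised at its bond, ONE `(C, δ)` for all bonds. -/
theorem exists_biLoc_dipPiece (ha : 0 < a) :
    ∃ C δ : ℝ, 0 < δ ∧ ∀ (κ : Fin 4) (u : Site 4), BiLoc (dipPiece n a κ u) u u C δ := by
  have h0 := rate0_pos n a ha
  have h8 : 0 < rate0 n a / 8 := div_pos h0 (by norm_num)
  have hcV := fun (κ : Fin 4) (u : Site 4) =>
    biLoc_cornerV (decays_Ggh_rate0 n a ha) (decays_Pgt n a ha) (biLoc_ghCur κ u (rate0 n a)) h0
  exact ⟨_, rate0 n a / 8, h8, fun κ u => biLoc_dSw u _ h8.le (biLoc_sub (hcV κ u) (biLoc_trK (hcV κ u)))⟩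

/-- [folklore] The needle ⊗ column piece is bi-localised at its bond, ONE `(C, δ)` for all bonds. -/
theorem exists_biLoc_ndlPiece (ha : 0 < a) (cQ : ℝ) :
    ∃ C δ : ℝ, 0 < δ ∧ ∀ (κ : Fin 4) (u : Site 4), BiLoc (ndlPiece n a cQ κ u) u u C δ := by
  have h0 := rate0_pos n a ha
  have h8 : 0 < rate0 n a / 8 := div_pos h0 (by norm_num)
  have hV := fun (κ : Fin 4) (u : Site 4) =>
    biLoc_cornerV (decays_Ggh_rate0 n a ha) (decays_Pgt n a ha) (biLoc_qAnti_rate0 n a κ u ha) h0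
  have hJ := fun (κ : Fin 4) (u : Site 4) =>
    biLoc_cornerJ (decays_Ggh_rate0 n a ha) (decays_Pgt n a ha) (biLoc_Jq_rate0 n a κ u ha) h0
  exact ⟨_, rate0 n a / 8, h8, fun κ u => biLoc_dSw u _ h8.le
    (biLoc_sub (biLoc_smul (biLoc_sub (hV κ u) (biLoc_trK (hV κ u))) cQ) (biLoc_sub (hJ κ u) (biLoc_trK (hJ κ u))))⟩

/-! ## §2 (CONV) per cell and the linear algebra of `fullSum` -/

/-- [folklore] **(CONV) FOR A CELL**: over a spread leg, two stencil families bi-localised at their bonds uniformly give a (1.22) series with convergent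
punctured partial sums at every base site. -/
theorem conv_cell {A : MKer 4 (Fin 4)} (hA : Spr A) {S T : StencilR} {Cs δs Ct δt : ℝ} (hS : ∀ κ u, BiLoc (S κ u) u u Cs δs) (hδs : 0 < δs)
    (hT : ∀ κ u, BiLoc (T κ u) u u Ct δt) (hδt : 0 < δt) (μ ν : Fin 4) (b : Pt) :
    ∃ B, Tendsto (psum (fun w : Pt => toReal w μ * toReal w ν * biBubbleTable A A S T μ ν (b + w) b)) atTop (𝓝 B) :=
  exists_tendsto_psum_weight_mul (absMoment₂_baseKer_biBubbleTable A A hA hA hS hδs hT hδt μ ν b) μ ν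

section FullSumAlgebra

variable {K₁ K₂ K₃ : Pt → ℝ}

omit [NeZero n] in
/-- [folklore] `fullSum (K₁ − K₂) = fullSum K₁ − fullSum K₂` on kernels with convergent partial sums. -/
theorem fullSum_sub (h₁ : ∃ B, Tendsto (psum K₁) atTop (𝓝 B)) (h₂ : ∃ B, Tendsto (psum K₂) atTop (𝓝 B)) :
    fullSum (fun w => K₁ w - K₂ w) = fullSum K₁ - fullSum K₂ := by
  have e : (fun w => K₁ w - K₂ w) = fun w => K₁ w + (-1) * K₂ w := funext fun w => by ring
  rw [e, fullSum_add h₁ (exists_tendsto_psum_const_mul (-1) h₂), fullSum_const_mul (-1) h₂]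
  ring

omit [NeZero n] in
/-- [folklore] convergent partial sums are closed under subtraction. -/
theorem conv_sub (h₁ : ∃ B, Tendsto (psum K₁) atTop (𝓝 B)) (h₂ : ∃ B, Tendsto (psum K₂) atTop (𝓝 B)) :
    ∃ B, Tendsto (psum (fun w => K₁ w - K₂ w)) atTop (𝓝 B) := by
  have e : (fun w => K₁ w - K₂ w) = fun w => K₁ w + (-1) * K₂ w := funext fun w => by ring
  rw [e]
  exact exists_tendsto_psum_add h₁ (exists_tendsto_psum_const_mul (-1) h₂)

omit [NeZero n] in
/-- [folklore] `fullSum (c·K₁ + K₂ − K₃) = c·fullSum K₁ + fullSum K₂ − fullSum K₃`. -/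
theorem fullSum_lin3 (c : ℝ) (h₁ : ∃ B, Tendsto (psum K₁) atTop (𝓝 B)) (h₂ : ∃ B, Tendsto (psum K₂) atTop (𝓝 B))
    (h₃ : ∃ B, Tendsto (psum K₃) atTop (𝓝 B)) :
    fullSum (fun w => c * K₁ w + K₂ w - K₃ w) = c * fullSum K₁ + fullSum K₂ - fullSum K₃ := by
  have h12 : ∃ B, Tendsto (psum (fun w => c * K₁ w + K₂ w)) atTop (𝓝 B) := exists_tendsto_psum_add (exists_tendsto_psum_const_mul c h₁) h₂
  rw [fullSum_sub (K₁ := fun w => c * K₁ w + K₂ w) h12 h₃, fullSum_add (exists_tendsto_psum_const_mul c h₁) h₂, fullSum_const_mul c h₁]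

omit [NeZero n] in
/-- [folklore] convergent partial sums of `c·K₁ + K₂ − K₃`. -/
theorem conv_lin3 (c : ℝ) (h₁ : ∃ B, Tendsto (psum K₁) atTop (𝓝 B)) (h₂ : ∃ B, Tendsto (psum K₂) atTop (𝓝 B))
    (h₃ : ∃ B, Tendsto (psum K₃) atTop (𝓝 B)) :
    ∃ B, Tendsto (psum (fun w => c * K₁ w + K₂ w - K₃ w)) atTop (𝓝 B) :=
  conv_sub (K₁ := fun w => c * K₁ w + K₂ w) (exists_tendsto_psum_add (exists_tendsto_psum_const_mul c h₁) h₂) h₃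

end FullSumAlgebra

omit [NeZero n] in
/-- [folklore] **THE NINE-TERM COMBINATION THROUGH `fullSum`**: with all nine kernels having convergent partial sums,
`fullSum (c·(c·K₁ + K₂ − K₃) + (c·K₄ + K₅ − K₆) − (c·K₇ + K₈ − K₉)) = c·(c·F₁ + F₂ − F₃) + (c·F₄ + F₅ − F₆) − (c·F₇ + F₈ − F₉)`. -/
theorem fullSum_nine (c : ℝ) {K₁ K₂ K₃ K₄ K₅ K₆ K₇ K₈ K₉ : Pt → ℝ}
    (h₁ : ∃ B, Tendsto (psum K₁) atTop (𝓝 B)) (h₂ : ∃ B, Tendsto (psum K₂) atTop (𝓝 B)) (h₃ : ∃ B, Tendsto (psum K₃) atTop (𝓝 B))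
    (h₄ : ∃ B, Tendsto (psum K₄) atTop (𝓝 B)) (h₅ : ∃ B, Tendsto (psum K₅) atTop (𝓝 B)) (h₆ : ∃ B, Tendsto (psum K₆) atTop (𝓝 B))
    (h₇ : ∃ B, Tendsto (psum K₇) atTop (𝓝 B)) (h₈ : ∃ B, Tendsto (psum K₈) atTop (𝓝 B)) (h₉ : ∃ B, Tendsto (psum K₉) atTop (𝓝 B)) :
    fullSum (fun w => c * (c * K₁ w + K₂ w - K₃ w) + (c * K₄ w + K₅ w - K₆ w) - (c * K₇ w + K₈ w - K₉ w))
      = c * (c * fullSum K₁ + fullSum K₂ - fullSum K₃) + (c * fullSum K₄ + fullSum K₅ - fullSum K₆)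
          - (c * fullSum K₇ + fullSum K₈ - fullSum K₉) := by
  have g₁ := conv_lin3 c h₁ h₂ h₃
  have g₂ := conv_lin3 c h₄ h₅ h₆
  have g₃ := conv_lin3 c h₇ h₈ h₉
  rw [fullSum_lin3 (K₁ := fun w => c * K₁ w + K₂ w - K₃ w) (K₂ := fun w => c * K₄ w + K₅ w - K₆ w)
    (K₃ := fun w => c * K₇ w + K₈ w - K₉ w) c g₁ g₂ g₃, fullSum_lin3 c h₁ h₂ h₃, fullSum_lin3 c h₄ h₅ h₆, fullSum_lin3 c h₇ h₈ h₉]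

/-! ## §3 The (1.22) sum of `SbRblk ⊗ SbRblk` is the weighted sum of the nine cell sums -/

variable (cK cQ : ℝ)

/-- [folklore] **THE (1.22) SUM OF `SbRblk ⊗ SbRblk` AT ONE BASE SITE = THE WEIGHTED SUM OF THE NINE CELL SUMS.** -/
theorem fullSum_SbRblk_SbRblk_eq (ha : 0 < a) (hGa : Spr (Ga n a)) (μ ν : Fin 4) (b : Pt) :
    fullSum (fun w : Pt => toReal w μ * toReal w ν * biBubbleTable (Ga n a) (Ga n a) (SbRblk n a cK cQ) (SbRblk n a cK cQ) μ ν (b + w) b) =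
      cK * (cK * fullSum (fun w : Pt => toReal w μ * toReal w ν * biBubbleTable (Ga n a) (Ga n a) (dipPiece n a) (dipPiece n a) μ ν (b + w) b)
          + fullSum (fun w : Pt => toReal w μ * toReal w ν * biBubbleTable (Ga n a) (Ga n a) (dipPiece n a) (ndlPiece n a cQ) μ ν (b + w) b)
          - fullSum (fun w : Pt => toReal w μ * toReal w ν * biBubbleTable (Ga n a) (Ga n a) (dipPiece n a) (projPiece n a) μ ν (b + w) b))
      + (cK * fullSum (fun w : Pt => toReal w μ * toReal w ν * biBubbleTable (Ga n a) (Ga n a) (ndlPiece n a cQ) (dipPiece n a) μ ν (b + w) b)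
          + fullSum (fun w : Pt => toReal w μ * toReal w ν * biBubbleTable (Ga n a) (Ga n a) (ndlPiece n a cQ) (ndlPiece n a cQ) μ ν (b + w) b)
          - fullSum (fun w : Pt => toReal w μ * toReal w ν * biBubbleTable (Ga n a) (Ga n a) (ndlPiece n a cQ) (projPiece n a) μ ν (b + w) b))
      - (cK * fullSum (fun w : Pt => toReal w μ * toReal w ν * biBubbleTable (Ga n a) (Ga n a) (projPiece n a) (dipPiece n a) μ ν (b + w) b)
          + fullSum (fun w : Pt => toReal w μ * toReal w ν * biBubbleTable (Ga n a) (Ga n a) (projPiece n a) (ndlPiece n a cQ) μ ν (b + w) b)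
          - fullSum (fun w : Pt => toReal w μ * toReal w ν * biBubbleTable (Ga n a) (Ga n a) (projPiece n a) (projPiece n a) μ ν (b + w) b)) := by
  obtain ⟨Cp, δp, hδp, hP⟩ := exists_biLoc_projPiece n a ha
  obtain ⟨Cd, δd, hδd, hD⟩ := exists_biLoc_dipPiece n a ha
  obtain ⟨Cn, δn, hδn, hN⟩ := exists_biLoc_ndlPiece n a ha cQ
  have e : (fun w : Pt => toReal w μ * toReal w ν * biBubbleTable (Ga n a) (Ga n a) (SbRblk n a cK cQ) (SbRblk n a cK cQ) μ ν (b + w) b) =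
      fun w : Pt => cK * (cK * (toReal w μ * toReal w ν * biBubbleTable (Ga n a) (Ga n a) (dipPiece n a) (dipPiece n a) μ ν (b + w) b)
            + (toReal w μ * toReal w ν * biBubbleTable (Ga n a) (Ga n a) (dipPiece n a) (ndlPiece n a cQ) μ ν (b + w) b)
            - (toReal w μ * toReal w ν * biBubbleTable (Ga n a) (Ga n a) (dipPiece n a) (projPiece n a) μ ν (b + w) b))
        + (cK * (toReal w μ * toReal w ν * biBubbleTable (Ga n a) (Ga n a) (ndlPiece n a cQ) (dipPiece n a) μ ν (b + w) b)
            + (toReal w μ * toReal w ν * biBubbleTable (Ga n a) (Ga n a) (ndlPiece n a cQ) (ndlPiece n a cQ) μ ν (b + w) b)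
            - (toReal w μ * toReal w ν * biBubbleTable (Ga n a) (Ga n a) (ndlPiece n a cQ) (projPiece n a) μ ν (b + w) b))
        - (cK * (toReal w μ * toReal w ν * biBubbleTable (Ga n a) (Ga n a) (projPiece n a) (dipPiece n a) μ ν (b + w) b)
            + (toReal w μ * toReal w ν * biBubbleTable (Ga n a) (Ga n a) (projPiece n a) (ndlPiece n a cQ) μ ν (b + w) b)
            - (toReal w μ * toReal w ν * biBubbleTable (Ga n a) (Ga n a) (projPiece n a) (projPiece n a) μ ν (b + w) b)) := by
    funext w
    rw [biBubbleTable_SbRblk_SbRblk_eq (n := n) (a := a) (cK := cK) (cQ := cQ) (κ := μ) (lam := ν) (p := b + w) (u := b) hGa ha]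
    ring
  rw [e]
  exact fullSum_nine cK (conv_cell hGa hD hδd hD hδd μ ν b) (conv_cell hGa hD hδd hN hδn μ ν b) (conv_cell hGa hD hδd hP hδp μ ν b)
    (conv_cell hGa hN hδn hD hδd μ ν b) (conv_cell hGa hN hδn hN hδn μ ν b) (conv_cell hGa hN hδn hP hδp μ ν b)
    (conv_cell hGa hP hδp hD hδd μ ν b) (conv_cell hGa hP hδp hN hδn μ ν b) (conv_cell hGa hP hδp hP hδp μ ν b)

/-- [folklore] the base average of a nine-term combination (linearity of finite sums). -/
theorem sum_avg_nine (s : Finset Pt) (r c : ℝ) (F₁ F₂ F₃ F₄ F₅ F₆ F₇ F₈ F₉ : Pt → ℝ) :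
    ∑ b ∈ s, r * (c * (c * F₁ b + F₂ b - F₃ b) + (c * F₄ b + F₅ b - F₆ b) - (c * F₇ b + F₈ b - F₉ b)) =
      c * (c * ∑ b ∈ s, r * F₁ b + ∑ b ∈ s, r * F₂ b - ∑ b ∈ s, r * F₃ b)
        + (c * ∑ b ∈ s, r * F₄ b + ∑ b ∈ s, r * F₅ b - ∑ b ∈ s, r * F₆ b)
        - (c * ∑ b ∈ s, r * F₇ b + ∑ b ∈ s, r * F₈ b - ∑ b ∈ s, r * F₉ b) := by
  have e : ∀ b ∈ s, r * (c * (c * F₁ b + F₂ b - F₃ b) + (c * F₄ b + F₅ b - F₆ b) - (c * F₇ b + F₈ b - F₉ b)) =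
      c * (c * (r * F₁ b)) + c * (r * F₂ b) - c * (r * F₃ b) + (c * (r * F₄ b) + r * F₅ b - r * F₆ b)
        - (c * (r * F₇ b) + r * F₈ b - r * F₉ b) := fun b _ => by ring
  rw [Finset.sum_congr rfl e]
  simp only [Finset.sum_add_distrib, Finset.sum_sub_distrib, ← Finset.mul_sum]
  ring

/-- [folklore] the triangle inequality for the nine-term combination, each term with its weight inside. -/
theorem abs_nine_le (c S₁ S₂ S₃ S₄ S₅ S₆ S₇ S₈ S₉ : ℝ) :
    |c * (c * S₁ + S₂ - S₃) + (c * S₄ + S₅ - S₆) - (c * S₇ + S₈ - S₉)| ≤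
      |c * c * S₁| + |c * S₂| + |c * S₃| + |c * S₄| + |S₅| + |S₆| + |c * S₇| + |S₈| + |S₉| := by
  have e : c * (c * S₁ + S₂ - S₃) + (c * S₄ + S₅ - S₆) - (c * S₇ + S₈ - S₉) =
      c * c * S₁ + c * S₂ + (-(c * S₃)) + c * S₄ + S₅ + (-S₆) + (-(c * S₇)) + (-S₈) + S₉ := by ring
  rw [e]
  have h3 : |(-(c * S₃))| = |c * S₃| := abs_neg _
  have h6 : |(-S₆)| = |S₆| := abs_neg _
  have h7 : |(-(c * S₇))| = |c * S₇| := abs_neg _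
  have h8 : |(-S₈)| = |S₈| := abs_neg _
  calc |c * c * S₁ + c * S₂ + -(c * S₃) + c * S₄ + S₅ + -S₆ + -(c * S₇) + -S₈ + S₉|
      ≤ |c * c * S₁ + c * S₂ + -(c * S₃) + c * S₄ + S₅ + -S₆ + -(c * S₇) + -S₈| + |S₉| := abs_add_le _ _
    _ ≤ |c * c * S₁ + c * S₂ + -(c * S₃) + c * S₄ + S₅ + -S₆ + -(c * S₇)| + |(-S₈)| + |S₉| :=
        add_le_add (abs_add_le _ _) le_rfl
    _ ≤ |c * c * S₁ + c * S₂ + -(c * S₃) + c * S₄ + S₅ + -S₆| + |(-(c * S₇))| + |(-S₈)| + |S₉| :=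
        add_le_add (add_le_add (abs_add_le _ _) le_rfl) le_rfl
    _ ≤ |c * c * S₁ + c * S₂ + -(c * S₃) + c * S₄ + S₅| + |(-S₆)| + |(-(c * S₇))| + |(-S₈)| + |S₉| :=
        add_le_add (add_le_add (add_le_add (abs_add_le _ _) le_rfl) le_rfl) le_rfl
    _ ≤ |c * c * S₁ + c * S₂ + -(c * S₃) + c * S₄| + |S₅| + |(-S₆)| + |(-(c * S₇))| + |(-S₈)| + |S₉| :=
        add_le_add (add_le_add (add_le_add (add_le_add (abs_add_le _ _) le_rfl) le_rfl) le_rfl) le_rfl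
    _ ≤ |c * c * S₁ + c * S₂ + -(c * S₃)| + |c * S₄| + |S₅| + |(-S₆)| + |(-(c * S₇))| + |(-S₈)| + |S₉| :=
        add_le_add (add_le_add (add_le_add (add_le_add (add_le_add (abs_add_le _ _) le_rfl) le_rfl) le_rfl) le_rfl) le_rfl
    _ ≤ |c * c * S₁ + c * S₂| + |(-(c * S₃))| + |c * S₄| + |S₅| + |(-S₆)| + |(-(c * S₇))| + |(-S₈)| + |S₉| :=
        add_le_add (add_le_add (add_le_add (add_le_add (add_le_add (add_le_add (abs_add_le _ _) le_rfl) le_rfl) le_rfl) le_rfl)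
          le_rfl) le_rfl
    _ ≤ |c * c * S₁| + |c * S₂| + |(-(c * S₃))| + |c * S₄| + |S₅| + |(-S₆)| + |(-(c * S₇))| + |(-S₈)| + |S₉| :=
        add_le_add (add_le_add (add_le_add (add_le_add (add_le_add (add_le_add (add_le_add (abs_add_le _ _) le_rfl) le_rfl) le_rfl)
          le_rfl) le_rfl) le_rfl) le_rfl
    _ = _ := by rw [h3, h6, h7, h8]

/-! ## §4 `h₃` from the nine cells -/

section Glue

variable {a} {N : ℝ} {cE cR cK cQ ωgl : ℕ → ℝ}

/-- the cell sum at scale `n`: `Σ_{b ∈ image resSite} n⁻⁴·fullSum (w ↦ w_μw_ν·biBubbleTable (Ga)(Ga) S T μ ν (b+w) b)` (local abbreviation, a plain function). -/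
def cellSum (n : ℕ) [NeZero n] (a : ℝ) (S T : StencilR) (μ ν : Fin 4) : ℝ :=
  ∑ b ∈ (univ : Finset (Fin 4 → Fin n)).image resSite, ((n : ℝ) ^ 4)⁻¹ *
    fullSum (fun w : Pt => toReal w μ * toReal w ν * biBubbleTable (Ga n a) (Ga n a) S T μ ν (b + w) b)

/-- [our object] Unfolding `cellSum`. -/
theorem cellSum_def (n : ℕ) [NeZero n] (a : ℝ) (S T : StencilR) (μ ν : Fin 4) :
    cellSum n a S T μ ν = ∑ b ∈ (univ : Finset (Fin 4 → Fin n)).image resSite, ((n : ℝ) ^ 4)⁻¹ *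
      fullSum (fun w : Pt => toReal w μ * toReal w ν * biBubbleTable (Ga n a) (Ga n a) S T μ ν (b + w) b) := rfl

/-- [folklore] **«GN-33 ∕ GLUE» — THE GLUON NEEDLE ROW `h₃` OF `NeedleRowGlue.abs_gN_row_le_of_tables` FROM ITS NINE CELLS.**  Displayed: `0 < a`, the END's
`hGa`, the pins `hlam`, `cE n = n⁴`, `cR n = −cE n`, and ONE n-uniform bound per cell of `SbRblk ⊗ SbRblk` with its weight (`cK²` for dip⊗dip, `cK` for the
dip cross cells, `1` otherwise).  Conclusion: `h₃` VERBATIM with `C₃ := 2N²·(C_dd + C_dn + C_dp + C_nd + C_nn + C_np + C_pd + C_pn + C_pp)`. -/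
theorem h₃_of_cells (ha : 0 < a) (hGa : ∀ n : ℕ, 2 ≤ n → ∀ [NeZero n], Spr (Ga n a))
    (hlam : ∀ n : ℕ, 2 ≤ n → ωgl n * cE n ^ 2 = 2 * N ^ 2 * (n : ℝ) ^ 8) (hcE : ∀ n : ℕ, 2 ≤ n → cE n = (n : ℝ) ^ 4)
    (hR : ∀ n : ℕ, 2 ≤ n → cR n = -cE n) (μ ν : Fin 4) {Cdd Cdn Cdp Cnd Cnn Cnp Cpd Cpn Cpp : ℝ}
    (hdd : ∀ n : ℕ, 2 ≤ n → ∀ [NeZero n], |cK n * cK n * cellSum n a (dipPiece n a) (dipPiece n a) μ ν| ≤ Cdd)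
    (hdn : ∀ n : ℕ, 2 ≤ n → ∀ [NeZero n], |cK n * cellSum n a (dipPiece n a) (ndlPiece n a (cQ n)) μ ν| ≤ Cdn)
    (hdp : ∀ n : ℕ, 2 ≤ n → ∀ [NeZero n], |cK n * cellSum n a (dipPiece n a) (projPiece n a) μ ν| ≤ Cdp)
    (hnd : ∀ n : ℕ, 2 ≤ n → ∀ [NeZero n], |cK n * cellSum n a (ndlPiece n a (cQ n)) (dipPiece n a) μ ν| ≤ Cnd)
    (hnn : ∀ n : ℕ, 2 ≤ n → ∀ [NeZero n], |cellSum n a (ndlPiece n a (cQ n)) (ndlPiece n a (cQ n)) μ ν| ≤ Cnn)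
    (hnp : ∀ n : ℕ, 2 ≤ n → ∀ [NeZero n], |cellSum n a (ndlPiece n a (cQ n)) (projPiece n a) μ ν| ≤ Cnp)
    (hpd : ∀ n : ℕ, 2 ≤ n → ∀ [NeZero n], |cK n * cellSum n a (projPiece n a) (dipPiece n a) μ ν| ≤ Cpd)
    (hpn : ∀ n : ℕ, 2 ≤ n → ∀ [NeZero n], |cellSum n a (projPiece n a) (ndlPiece n a (cQ n)) μ ν| ≤ Cpn)
    (hpp : ∀ n : ℕ, 2 ≤ n → ∀ [NeZero n], |cellSum n a (projPiece n a) (projPiece n a) μ ν| ≤ Cpp) :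
    ∀ n : ℕ, 2 ≤ n → ∀ [NeZero n], |ωgl n * ∑ b ∈ (univ : Finset (Fin 4 → Fin n)).image resSite, ((n : ℝ) ^ 4)⁻¹ * (((n : ℝ) ^ 8)⁻¹ *
      fullSum (fun w : Pt => toReal w μ * toReal w ν *
        biBubbleTable (Ga n a) (Ga n a) (SbRc n a (cE n) (cR n) (cK n) (cQ n)) (SbRc n a (cE n) (cR n) (cK n) (cQ n)) μ ν (b + w) b))|
      ≤ 2 * N ^ 2 * (Cdd + Cdn + Cdp + Cnd + Cnn + Cnp + Cpd + Cpn + Cpp) := by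
  intro n hn _
  have hGa' := hGa n hn
  have hpre : ωgl n * (cR n * cR n) * ((n : ℝ) ^ 8)⁻¹ = 2 * N ^ 2 :=
    prefactor₃_eq (n := n) (cE := cE n) (cR := cR n) (ωgl := ωgl n) (N := N) (hlam n hn) (hcE n hn) (hR n hn)
  have hsign : cR n + cE n = 0 := by rw [hR n hn]; ring
  obtain ⟨Cs, δs, hδs, hS⟩ := exists_biLoc_SbRblk n a (cK n) (cQ n) ha
  -- step 1: SbRc ⊗ SbRc = cR² · SbRblk ⊗ SbRblk inside the (1.22) sum, and the constant comes out
  have e1 : ∀ b : Pt, fullSum (fun w : Pt => toReal w μ * toReal w ν *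
        biBubbleTable (Ga n a) (Ga n a) (SbRc n a (cE n) (cR n) (cK n) (cQ n)) (SbRc n a (cE n) (cR n) (cK n) (cQ n)) μ ν (b + w) b)
      = cR n * cR n * fullSum (fun w : Pt => toReal w μ * toReal w ν *
        biBubbleTable (Ga n a) (Ga n a) (SbRblk n a (cK n) (cQ n)) (SbRblk n a (cK n) (cQ n)) μ ν (b + w) b) := by
    intro b
    have e : (fun w : Pt => toReal w μ * toReal w ν *
        biBubbleTable (Ga n a) (Ga n a) (SbRc n a (cE n) (cR n) (cK n) (cQ n)) (SbRc n a (cE n) (cR n) (cK n) (cQ n)) μ ν (b + w) b)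
        = fun w : Pt => cR n * cR n * (toReal w μ * toReal w ν *
          biBubbleTable (Ga n a) (Ga n a) (SbRblk n a (cK n) (cQ n)) (SbRblk n a (cK n) (cQ n)) μ ν (b + w) b) := by
      funext w
      rw [biBubbleTable_SbRc_SbRc_eq (n := n) (a := a) (cE := cE n) (cR := cR n) (cK := cK n) (cQ := cQ n) (κ := μ) (lam := ν)
        (p := b + w) (u := b) (Ga n a) (Ga n a) hsign]
      ring
    rw [e, fullSum_const_mul _ (conv_cell hGa' hS hδs hS hδs μ ν b)]
  -- step 2: the base average of the SbRblk word is the nine-term combination of the cell sums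
  have e2 : ∑ b ∈ (univ : Finset (Fin 4 → Fin n)).image resSite, ((n : ℝ) ^ 4)⁻¹ * (((n : ℝ) ^ 8)⁻¹ *
      fullSum (fun w : Pt => toReal w μ * toReal w ν *
        biBubbleTable (Ga n a) (Ga n a) (SbRc n a (cE n) (cR n) (cK n) (cQ n)) (SbRc n a (cE n) (cR n) (cK n) (cQ n)) μ ν (b + w) b))
      = ((n : ℝ) ^ 8)⁻¹ * (cR n * cR n) *
        (cK n * (cK n * cellSum n a (dipPiece n a) (dipPiece n a) μ ν + cellSum n a (dipPiece n a) (ndlPiece n a (cQ n)) μ ν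
              - cellSum n a (dipPiece n a) (projPiece n a) μ ν)
          + (cK n * cellSum n a (ndlPiece n a (cQ n)) (dipPiece n a) μ ν + cellSum n a (ndlPiece n a (cQ n)) (ndlPiece n a (cQ n)) μ ν
              - cellSum n a (ndlPiece n a (cQ n)) (projPiece n a) μ ν)
          - (cK n * cellSum n a (projPiece n a) (dipPiece n a) μ ν + cellSum n a (projPiece n a) (ndlPiece n a (cQ n)) μ ν
              - cellSum n a (projPiece n a) (projPiece n a) μ ν)) := by
    simp only [cellSum_def]
    rw [← sum_avg_nine]
    rw [Finset.mul_sum]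
    refine Finset.sum_congr rfl fun b _ => ?_
    rw [e1 b, fullSum_SbRblk_SbRblk_eq n a (cK n) (cQ n) ha hGa' μ ν b]
    ring
  rw [e2]
  -- step 3: the prefactor and the triangle inequality
  have e3 : ωgl n * (((n : ℝ) ^ 8)⁻¹ * (cR n * cR n) *
      (cK n * (cK n * cellSum n a (dipPiece n a) (dipPiece n a) μ ν + cellSum n a (dipPiece n a) (ndlPiece n a (cQ n)) μ ν
            - cellSum n a (dipPiece n a) (projPiece n a) μ ν)
        + (cK n * cellSum n a (ndlPiece n a (cQ n)) (dipPiece n a) μ ν + cellSum n a (ndlPiece n a (cQ n)) (ndlPiece n a (cQ n)) μ ν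
            - cellSum n a (ndlPiece n a (cQ n)) (projPiece n a) μ ν)
        - (cK n * cellSum n a (projPiece n a) (dipPiece n a) μ ν + cellSum n a (projPiece n a) (ndlPiece n a (cQ n)) μ ν
            - cellSum n a (projPiece n a) (projPiece n a) μ ν)))
      = 2 * N ^ 2 *
        (cK n * (cK n * cellSum n a (dipPiece n a) (dipPiece n a) μ ν + cellSum n a (dipPiece n a) (ndlPiece n a (cQ n)) μ ν
              - cellSum n a (dipPiece n a) (projPiece n a) μ ν)
          + (cK n * cellSum n a (ndlPiece n a (cQ n)) (dipPiece n a) μ ν + cellSum n a (ndlPiece n a (cQ n)) (ndlPiece n a (cQ n)) μ ν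
              - cellSum n a (ndlPiece n a (cQ n)) (projPiece n a) μ ν)
          - (cK n * cellSum n a (projPiece n a) (dipPiece n a) μ ν + cellSum n a (projPiece n a) (ndlPiece n a (cQ n)) μ ν
              - cellSum n a (projPiece n a) (projPiece n a) μ ν)) := by
    rw [← hpre]; ring
  rw [e3, abs_mul, abs_of_nonneg (by positivity : (0 : ℝ) ≤ 2 * N ^ 2)]
  refine mul_le_mul_of_nonneg_left ?_ (by positivity)
  refine (abs_nine_le _ _ _ _ _ _ _ _ _ _).trans ?_
  have h1 := hdd n hn; have h2 := hdn n hn; have h3 := hdp n hn; have h4 := hnd n hn; have h5 := hnn n hn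
  have h6 := hnp n hn; have h7 := hpd n hn; have h8 := hpn n hn; have h9 := hpp n hn
  linarith

end Glue

end Summit.QuantumFields.BalabanUV.Beta.D1BFx.GluonNeedleGlue

end
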